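import Mathlib

/-!
# A2BaseChange — the base-change parentheses of Lemma A4.2.2

route/T4-A2-p6.md (cell pub-hodge-repro2, Tier 4, sub-claim A2), Lemma A4.2.2: «… `p_2 ⊗ ℂ` is the
projector onto `⊕_ν ℓ_{i,τ_ν} ∧ ℓ_{i,τ̄_ν}`, `p_2² = p_2` (an identity of `ℚ`-linear maps is checked after
`⊗ℂ`), and `D_i ⊗ ℂ = (p_2 ⊗ ℂ)(H^2(X, ℂ)) = ⊕_ν ℓ_{i,τ_ν} ∧ ℓ_{i,τ̄_ν}` (the image of a `ℚ`-linear map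
commutes with base change), of dimension `3`.»

Kernel-checked here, for an arbitrary field extension `K / F` and `F`-vector spaces `V`, `W`:
* `baseChange_injective`: `f ⊗ K = g ⊗ K ⇒ f = g` (the map `v ↦ 1 ⊗ v` is injective, `K` being a faithful
  flat `F`-module); hence `isIdempotentElem_of_baseChange`: if `p ⊗ K` is idempotent, so is `p`;
* `range_baseChange`: `im (f ⊗ K) = (im f) ⊗ K`;
* `finrank_range_baseChange`: `dim_K (im (f ⊗ K)) = dim_F (im f)` — the «of dimension `3`».
Nothing specific to `ℚ`, `ℂ` or the cohomology of `A_i` is used; the application is `F = ℚ`, `K = ℂ`,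
`V = H^2(A_i, ℚ)`, `p = p_2 = P_2(ι_i(x)^*)`.
-/

namespace Summit.Ventures.HodgeRepro2.A2BaseChange

open TensorProduct

variable {F K : Type*} [Field F] [Field K] [Algebra F K]
  {V W : Type*} [AddCommGroup V] [Module F V] [AddCommGroup W] [Module F W]

/-- «An identity of `ℚ`-linear maps is checked after `⊗ℂ`»: base change along a field extension is
injective on linear maps. -/
theorem baseChange_injective :
    Function.Injective (LinearMap.baseChange K : (V →ₗ[F] W) → (K ⊗[F] V →ₗ[K] K ⊗[F] W)) := by
  intro f g h
  ext v
  have h1 := congrArg (fun φ : K ⊗[F] V →ₗ[K] K ⊗[F] W => φ ((1 : K) ⊗ₜ[F] v)) h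
  simp only [LinearMap.baseChange_tmul] at h1
  exact Module.Flat.tensorProduct_mk_injective F W K h1

/-- Lemma A4.2.2: `p_2² = p_2` is checked after `⊗ℂ` — if `p ⊗ K` is idempotent then `p` is. -/
theorem isIdempotentElem_of_baseChange {p : Module.End F V}
    (h : IsIdempotentElem (p.baseChange K)) : IsIdempotentElem p := by
  apply baseChange_injective (K := K)
  rw [LinearMap.baseChange_mul]
  exact h

/-- «The image of a `ℚ`-linear map commutes with base change»: `im (f ⊗ K) = (im f) ⊗ K`. -/
theorem range_baseChange (f : V →ₗ[F] W) :
    LinearMap.range (f.baseChange K) = (LinearMap.range f).baseChange K := by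
  apply le_antisymm
  · rintro x ⟨y, rfl⟩
    induction y using TensorProduct.induction_on with
    | zero => simp
    | tmul k v =>
      rw [LinearMap.baseChange_tmul]
      exact Submodule.tmul_mem_baseChange_of_mem k (LinearMap.mem_range_self f v)
    | add x y hx hy =>
      rw [map_add]
      exact Submodule.add_mem _ hx hy
  · rw [Submodule.baseChange_eq_span]
    apply Submodule.span_le.2
    intro x hx
    rw [SetLike.mem_coe, Submodule.mem_map] at hx
    obtain ⟨w, hw, rfl⟩ := hx
    obtain ⟨v, rfl⟩ := LinearMap.mem_range.1 hw
    exact ⟨(1 : K) ⊗ₜ[F] v, by rw [LinearMap.baseChange_tmul]; rfl⟩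

/-- The base change of a subspace is the image of the (injective) base change of its inclusion, so its
dimension is the dimension of the subspace: `dim_K (p ⊗ K) = dim_F p`. -/
theorem finrank_baseChange (p : Submodule F V) :
    Module.finrank K (p.baseChange K) = Module.finrank F p := by
  have hinj : Function.Injective (p.subtype.baseChange K) := by
    rw [LinearMap.baseChange_eq_ltensor]
    exact Module.Flat.lTensor_preserves_injective_linearMap p.subtype p.injective_subtype
  have hr : LinearMap.range (p.subtype.baseChange K) = p.baseChange K := by
    rw [range_baseChange, Submodule.range_subtype]
  rw [← hr, LinearMap.finrank_range_of_inj hinj, Module.finrank_baseChange]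

/-- Lemma A4.2.2, «of dimension `3`»: the dimension of the image is unchanged by base change,
`dim_K (im (f ⊗ K)) = dim_F (im f)` (so `dim_ℚ D_i = dim_ℂ (D_i ⊗ ℂ) = 3`). -/
theorem finrank_range_baseChange (f : V →ₗ[F] W) :
    Module.finrank K (LinearMap.range (f.baseChange K)) = Module.finrank F (LinearMap.range f) := by
  rw [range_baseChange]
  exact finrank_baseChange (LinearMap.range f)

end Summit.Ventures.HodgeRepro2.A2BaseChange
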